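import Mathlib
import Literature.NumberTheory.Sieve.CoprimeSquarefreeSums
import HarnessLib

/-!
# Tools for Vinogradov's estimate of exponential sums over primes

Elementary, fully proved lemmas feeding the proof of Vinogradov's bound
`∑_{p ≤ N} (log p) e(pα) ≪ (N q^{-1/2} + N^{4/5} + N^{1/2} q^{1/2}) (log N)⁴` (`|α - a/q| ≤ q⁻²`,
`(a, q) = 1`) in the textbook form of M. B. Nathanson, *Additive Number Theory: the Classical
Bases*, GTM 164 (1996), §4.4 and §8.5 [Nathanson1996] — the named fact
`Literature.NumberTheory.Sieve.MontgomeryVaughan1975.vinogradov_expSum_bound` (= LEMMA 3.1 of Montgomery–Vaughan, Acta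
Arith. 27 (1975) [MontgomeryVaughanActa1975]). Contents:

* `distInt x = |x - round x|`, the distance from `x` to the nearest integer (the `‖x‖` of
  analytic number theory; it is the norm of `x` in `UnitAddCircle`, `distInt_eq_norm_coe`), and
  `geomBound V x = min (V, 1/(2‖x‖))`;
* Lemma 4.7: `‖∑_{a < n ≤ b} e(nx)‖ ≤ min (b - a, 1/(2‖x‖))`
  (`norm_sum_Ioc_fourierChar_le_geomBound`);
* a well-spacing substitute for Lemmas 4.8–4.9: if finitely many points are pairwise
  `δ`-separated modulo `1`, then `∑ min (V, 1/(2‖xᵢ‖)) ≤ 2V + δ⁻¹ (1 + log m)` for `m ≥ 1/(2δ)`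
  (`sum_geomBound_le_of_separated`), and the separation `‖αm‖ ≥ 1/(2q)` for `0 < |m| ≤ q/2`
  when `|α - a/q| ≤ q⁻²`, `(a, q) = 1` (`le_distInt_mul_of_abs_le`);
* Lemma 4.10 in the explicit form
  `∑_{k ≤ U} min (N/k, 1/(2‖αk‖)) ≤ 4 (N/q + U + q) (1 + log (qU))` (`sum_geomBound_div_le`);
* partial summation with logarithmic weights (proof of Lemma 8.6):
  `‖∑_{r ≤ M} (log r) e(rx)‖ ≤ 2 log M · min (V, 1/(2‖x‖))` for `M ≤ V`
  (`norm_sum_log_mul_fourierChar_le`);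
* `afExpSum f N α = ∑_{n ≤ N} f(n) e(nα)` and the expansion of `afExpSum (f * g)` over
  factorisations (`afExpSum_mul`, via the hyperbola rearrangement
  `Literature.NumberTheory.Sieve.SquarefreeSums.sum_Icc_sum_divisorsAntidiagonal` of `CoprimeSquarefreeSums.lean`), the form
  in which Vaughan's identity is summed in `Literature/NumberTheory/Sieve/VinogradovExpSum.lean`.

The divisor mean square `∑_{k ≤ x} d(k)² ≤ x (1 + log x)³` (Nathanson's Theorem A.14) needed for
the type II sums is not repeated here: it is `Literature.NumberTheory.Sieve.Vaughan.sum_sq_card_divisors_le`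
(`VaughanMeanValueDecomposition.lean`), used directly in `VinogradovExpSum.lean`.

All constants are explicit; nothing in this file is a named fact (everything is proved).
-/

noncomputable section

open Finset Real

open scoped FourierTransform Pointwise

namespace Literature.NumberTheory.Sieve.Vinogradov

/-! ### Distance to the nearest integer -/

/-- `‖x‖ = |x - round x|`, the distance from the real number `x` to the nearest integer
(Nathanson, GTM 164, §4.4). It equals the norm of `x` in `UnitAddCircle = ℝ/ℤ`
(`distInt_eq_norm_coe`); we keep it as a plain real function for summation purposes. [folklore] -/
def distInt (x : ℝ) : ℝ := |x - round x|

/-- `‖x‖ ≥ 0`. [folklore] -/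
theorem distInt_nonneg (x : ℝ) : 0 ≤ distInt x := abs_nonneg _

/-- `‖x‖ ≤ 1/2`. [folklore] -/
theorem distInt_le_half (x : ℝ) : distInt x ≤ 1 / 2 := abs_sub_round x

/-- `‖x‖ ≤ |x - n|` for every integer `n`. [folklore] -/
theorem distInt_le_abs_sub_int (x : ℝ) (n : ℤ) : distInt x ≤ |x - n| := round_le x n

/-- `‖x + n‖ = ‖x‖` for `n ∈ ℤ`. [folklore] -/
theorem distInt_add_int (x : ℝ) (n : ℤ) : distInt (x + n) = distInt x := by
  unfold distInt
  rw [round_add_intCast]; push_cast; ring_nf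

/-- `‖n‖ = 0` for `n ∈ ℤ`. [folklore] -/
theorem distInt_intCast (n : ℤ) : distInt n = 0 := by
  simp [distInt]

/-- `‖0‖ = 0`. [folklore] -/
theorem distInt_zero : distInt 0 = 0 := by
  simp [distInt]

/-- `‖-x‖ = ‖x‖`. [folklore] -/
theorem distInt_neg (x : ℝ) : distInt (-x) = distInt x := by
  have key : ∀ y : ℝ, distInt (-y) ≤ distInt y := fun y =>
    calc distInt (-y) ≤ |-y - ((-round y : ℤ) : ℝ)| := distInt_le_abs_sub_int _ _
      _ = distInt y := by rw [distInt, ← abs_neg]; push_cast; ring_nf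
  exact le_antisymm (key x) (by simpa using key (-x))

/-- Triangle inequality `‖x + y‖ ≤ ‖x‖ + ‖y‖` (Nathanson (4.3)). [folklore] -/
theorem distInt_add_le (x y : ℝ) : distInt (x + y) ≤ distInt x + distInt y := by
  calc distInt (x + y) ≤ |x + y - ((round x + round y : ℤ) : ℝ)| := distInt_le_abs_sub_int _ _
    _ = |(x - round x) + (y - round y)| := by push_cast; ring_nf
    _ ≤ distInt x + distInt y := abs_add_le _ _

/-- `‖x - y‖ ≤ ‖x‖ + ‖y‖`. [folklore] -/
theorem distInt_sub_le (x y : ℝ) : distInt (x - y) ≤ distInt x + distInt y := by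
  simpa [sub_eq_add_neg, distInt_neg] using distInt_add_le x (-y)

/-- `‖y‖ - ‖x - y‖ ≤ ‖x‖`. [folklore] -/
theorem distInt_sub_distInt_le (x y : ℝ) : distInt y - distInt (x - y) ≤ distInt x := by
  have h1 := distInt_sub_le x (x - y)
  rw [sub_sub_cancel] at h1
  linarith

/-- `‖x‖ = 0 ↔ x ∈ ℤ`. [folklore] -/
theorem distInt_eq_zero_iff {x : ℝ} : distInt x = 0 ↔ ∃ n : ℤ, x = n := by
  constructor
  · intro h
    refine ⟨round x, ?_⟩
    have := abs_eq_zero.mp h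
    linarith
  · rintro ⟨n, rfl⟩
    exact distInt_intCast n

/-- Link with Mathlib: `‖x‖` is the norm of `x` in `UnitAddCircle = ℝ/ℤ`. [folklore] -/
theorem distInt_eq_norm_coe (x : ℝ) : distInt x = ‖((x : ℝ) : UnitAddCircle)‖ := by
  rw [AddCircle.norm_eq, distInt]; simp

/-- Jordan's inequality in the form `2‖x‖ ≤ |sin (πx)|` (Nathanson, Lemma 4.6). [folklore] -/
theorem two_mul_distInt_le_abs_sin (x : ℝ) : 2 * distInt x ≤ |Real.sin (π * x)| := by
  set t : ℝ := x - round x with ht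
  have hx : x = t + round x := by rw [ht]; ring
  have hsin : |Real.sin (π * x)| = |Real.sin (π * t)| := by
    rw [hx, mul_add, show π * ((round x : ℤ) : ℝ) = ((round x : ℤ) : ℝ) * π by ring,
      Real.sin_add_int_mul_pi]
    simp [abs_mul]
  rw [hsin]
  have ht2 : |t| ≤ 1 / 2 := abs_sub_round x
  have hpi := Real.pi_pos
  have key : 2 * |t| ≤ Real.sin (π * |t|) := by
    have h1 : (2 / π) * (π * |t|) ≤ Real.sin (π * |t|) :=
      Real.mul_le_sin (by positivity) (by nlinarith [abs_nonneg t])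
    calc 2 * |t| = (2 / π) * (π * |t|) := by field_simp
      _ ≤ _ := h1
  have h3 : Real.sin (π * |t|) = |Real.sin (π * t)| := by
    rcases abs_choice t with h | h
    · rw [h]
      symm
      apply abs_of_nonneg
      exact Real.sin_nonneg_of_nonneg_of_le_pi (by nlinarith [abs_nonneg t])
        (by nlinarith [abs_nonneg t])
    · rw [h, mul_neg, Real.sin_neg]
      symm
      have hle : Real.sin (π * t) ≤ 0 := by
        have h0 : 0 ≤ Real.sin (π * -t) :=
          Real.sin_nonneg_of_nonneg_of_le_pi (by nlinarith [abs_nonneg t])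
            (by nlinarith [abs_nonneg t])
        simpa [mul_neg, Real.sin_neg] using h0
      exact abs_of_nonpos hle
  rw [← h3]
  simpa [distInt, ht] using key

/-! ### Geometric sums (Nathanson, Lemma 4.7) -/

/-- `e(nx) = e(x)ⁿ`. [folklore] -/
theorem fourierChar_natCast_mul (n : ℕ) (x : ℝ) : (𝐞 ((n : ℝ) * x) : ℂ) = (𝐞 x : ℂ) ^ n := by
  rw [← nsmul_eq_mul, AddChar.map_nsmul_eq_pow, Circle.coe_pow]

/-- `|e(x)| = 1`. [folklore] -/
theorem norm_fourierChar (x : ℝ) : ‖(𝐞 x : ℂ)‖ = 1 := Circle.norm_coe _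

/-- `|e(x) - 1| = 2 |sin (πx)|`. [folklore] -/
theorem norm_fourierChar_sub_one (x : ℝ) : ‖(𝐞 x : ℂ) - 1‖ = 2 * |Real.sin (π * x)| := by
  rw [Real.fourierChar_apply]
  have h := Complex.norm_exp_I_mul_ofReal_sub_one (2 * π * x)
  rw [mul_comm Complex.I] at h
  rw [h]
  simp only [norm_mul, Real.norm_eq_abs]
  congr 1
  · norm_num
  · congr 1; ring

/-- **Nathanson, Lemma 4.7** (trivial part): `|∑_{a < n ≤ b} e(nx)| ≤ b - a`.
[cite: Nathanson1996, §4.4, Lemma 4.7] -/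
theorem norm_sum_Ioc_fourierChar_le_sub (a b : ℕ) (x : ℝ) :
    ‖∑ n ∈ Ioc a b, (𝐞 ((n : ℝ) * x) : ℂ)‖ ≤ ((b - a : ℕ) : ℝ) := by
  calc ‖∑ n ∈ Ioc a b, (𝐞 ((n : ℝ) * x) : ℂ)‖ ≤ ∑ n ∈ Ioc a b, ‖(𝐞 ((n : ℝ) * x) : ℂ)‖ :=
        norm_sum_le _ _
    _ = ((b - a : ℕ) : ℝ) := by simp

/-- **Nathanson, Lemma 4.7** (main part): `|∑_{a < n ≤ b} e(nx)| · ‖x‖ ≤ 1/2`, i.e. the geometric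
sum is at most `1/(2‖x‖)` (from `|e(x) - 1| = 2 |sin πx| ≥ 4‖x‖`).
[cite: Nathanson1996, §4.4, Lemma 4.7] -/
theorem norm_sum_Ioc_fourierChar_mul_distInt_le (a b : ℕ) (x : ℝ) :
    ‖∑ n ∈ Ioc a b, (𝐞 ((n : ℝ) * x) : ℂ)‖ * distInt x ≤ 1 / 2 := by
  by_cases hx : distInt x = 0
  · rw [hx, mul_zero]; norm_num
  have hdpos : 0 < distInt x := lt_of_le_of_ne (distInt_nonneg x) (Ne.symm hx)
  have hsin : 0 < |Real.sin (π * x)| :=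
    lt_of_lt_of_le (by linarith) (two_mul_distInt_le_abs_sin x)
  have hne : (𝐞 x : ℂ) - 1 ≠ 0 := by
    intro h0
    have := norm_fourierChar_sub_one x
    rw [h0, norm_zero] at this
    linarith
  rcases le_or_gt b a with hab | hab
  · simp [Finset.Ioc_eq_empty_of_le hab]
  have hsum : ∑ n ∈ Ioc a b, (𝐞 ((n : ℝ) * x) : ℂ) =
      (𝐞 x : ℂ) ^ (a + 1) * ∑ j ∈ range (b - a), (𝐞 x : ℂ) ^ j := by
    rw [Finset.mul_sum]
    have : Ioc a b = Ico (a + 1) (b + 1) := by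
      ext n; simp only [Finset.mem_Ioc, Finset.mem_Ico]; omega
    rw [this, Finset.sum_Ico_eq_sum_range]
    refine Finset.sum_congr (by congr 1; omega) fun j _ => ?_
    rw [fourierChar_natCast_mul, ← pow_add]
  have hgeom : ∑ j ∈ range (b - a), (𝐞 x : ℂ) ^ j =
      ((𝐞 x : ℂ) ^ (b - a) - 1) / ((𝐞 x : ℂ) - 1) :=
    geom_sum_eq (fun h1 => hne (by rw [h1, sub_self])) _
  have hnorm : ‖∑ n ∈ Ioc a b, (𝐞 ((n : ℝ) * x) : ℂ)‖ ≤ 2 / ‖(𝐞 x : ℂ) - 1‖ := by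
    rw [hsum, hgeom, norm_mul, norm_pow, norm_fourierChar, one_pow, one_mul, norm_div]
    gcongr
    calc ‖(𝐞 x : ℂ) ^ (b - a) - 1‖ ≤ ‖(𝐞 x : ℂ) ^ (b - a)‖ + ‖(1 : ℂ)‖ := norm_sub_le _ _
      _ = 2 := by rw [norm_pow, norm_fourierChar]; norm_num
  rw [norm_fourierChar_sub_one] at hnorm
  calc ‖∑ n ∈ Ioc a b, (𝐞 ((n : ℝ) * x) : ℂ)‖ * distInt x
      ≤ 2 / (2 * |Real.sin (π * x)|) * distInt x := by gcongr
    _ = distInt x / |Real.sin (π * x)| := by field_simp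
    _ ≤ distInt x / (2 * distInt x) := by
        gcongr
        exact two_mul_distInt_le_abs_sin x
    _ = 1 / 2 := by field_simp

/-- The standard majorant `min (V, 1/(2‖x‖))` of geometric sums of length `≤ V`
(Nathanson, Lemma 4.7), with the convention that it is `V` when `x ∈ ℤ`. [folklore] -/
def geomBound (V x : ℝ) : ℝ := if distInt x = 0 then V else min V (1 / (2 * distInt x))

/-- `min (V, 1/(2‖x‖)) ≤ V`. [folklore] -/
theorem geomBound_le (V x : ℝ) : geomBound V x ≤ V := by
  unfold geomBound; split_ifs <;> simp

/-- `min (V, 1/(2‖x‖)) ≤ 1/(2‖x‖)` when `x ∉ ℤ`. [folklore] -/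
theorem geomBound_le_inv {x : ℝ} (V : ℝ) (h : 0 < distInt x) :
    geomBound V x ≤ 1 / (2 * distInt x) := by
  unfold geomBound
  rw [if_neg h.ne']
  exact min_le_right _ _

/-- `min (V, 1/(2‖x‖)) ≥ 0` for `V ≥ 0`. [folklore] -/
theorem geomBound_nonneg {V : ℝ} (hV : 0 ≤ V) (x : ℝ) : 0 ≤ geomBound V x := by
  unfold geomBound; split_ifs
  · exact hV
  · exact le_min hV (by have := distInt_nonneg x; positivity)

/-- `min (V, 1/(2‖x‖)) · ‖x‖ ≤ 1/2`. [folklore] -/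
theorem geomBound_mul_distInt_le (V x : ℝ) : geomBound V x * distInt x ≤ 1 / 2 := by
  unfold geomBound; split_ifs with h
  · rw [h, mul_zero]; norm_num
  · have hd : 0 < distInt x := lt_of_le_of_ne (distInt_nonneg x) (Ne.symm h)
    calc min V (1 / (2 * distInt x)) * distInt x ≤ 1 / (2 * distInt x) * distInt x := by
          gcongr; exact min_le_right _ _
      _ = 1 / 2 := by field_simp

/-- Monotonicity of `min (V, 1/(2‖x‖))` in `V`. [folklore] -/
theorem geomBound_mono {V W : ℝ} (h : V ≤ W) (x : ℝ) : geomBound V x ≤ geomBound W x := by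
  unfold geomBound; split_ifs
  · exact h
  · exact min_le_min_right _ h

/-- `min (V, 1/(2‖-x‖)) = min (V, 1/(2‖x‖))`. [folklore] -/
theorem geomBound_neg (V x : ℝ) : geomBound V (-x) = geomBound V x := by
  unfold geomBound; rw [distInt_neg]

/-- `min (V, 1/(2‖0‖)) = V`. [folklore] -/
theorem geomBound_zero (V : ℝ) : geomBound V 0 = V := by
  simp [geomBound, distInt_zero]

/-- **Nathanson, Lemma 4.7**: `|∑_{a < n ≤ b} e(nx)| ≤ min (V, 1/(2‖x‖))` whenever `b - a ≤ V`.
[cite: Nathanson1996, §4.4, Lemma 4.7] -/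
theorem norm_sum_Ioc_fourierChar_le_geomBound {a b : ℕ} {V : ℝ} (x : ℝ)
    (hV : ((b - a : ℕ) : ℝ) ≤ V) :
    ‖∑ n ∈ Ioc a b, (𝐞 ((n : ℝ) * x) : ℂ)‖ ≤ geomBound V x := by
  have h1 := (norm_sum_Ioc_fourierChar_le_sub a b x).trans hV
  unfold geomBound; split_ifs with h
  · exact h1
  · refine le_min h1 ?_
    have hd : 0 < distInt x := lt_of_le_of_ne (distInt_nonneg x) (Ne.symm h)
    rw [le_div_iff₀ (by positivity)]
    have := norm_sum_Ioc_fourierChar_mul_distInt_le a b x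
    linarith

/-- Lemma 4.7 for an initial segment: `|∑_{1 ≤ n ≤ k} e(nx)| ≤ min (V, 1/(2‖x‖))` for `k ≤ V`.
[cite: Nathanson1996, §4.4, Lemma 4.7] -/
theorem norm_sum_Icc_fourierChar_le_geomBound {k : ℕ} {V : ℝ} (x : ℝ) (hk : (k : ℝ) ≤ V) :
    ‖∑ n ∈ Icc 1 k, (𝐞 ((n : ℝ) * x) : ℂ)‖ ≤ geomBound V x := by
  have hI : Icc 1 k = Ioc 0 k := by ext n; simp only [Finset.mem_Icc, Finset.mem_Ioc]; omega
  rw [hI]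
  exact norm_sum_Ioc_fourierChar_le_geomBound x (by simpa using hk)

/-! ### Well-spaced points (a substitute for Nathanson's Lemmas 4.8–4.9) -/

section WellSpaced

variable {ι : Type*} (S : Finset ι) (x : ι → ℝ) {δ : ℝ}

/-- If the points `x i`, `i ∈ S`, are pairwise `δ`-separated modulo `1`, then at most two of them
have `‖x i‖` in a window `[a, a + δ)`: at most one with `x i - round (x i) ≥ 0` and at most one
with `x i - round (x i) < 0`. [folklore] -/
theorem card_filter_distInt_mem_Ico_le_two
    (hsep : ∀ i ∈ S, ∀ j ∈ S, i ≠ j → δ ≤ distInt (x i - x j)) (a : ℝ) :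
    (S.filter fun i => a ≤ distInt (x i) ∧ distInt (x i) < a + δ).card ≤ 2 := by
  classical
  set F := S.filter fun i => a ≤ distInt (x i) ∧ distInt (x i) < a + δ with hF
  have key : Set.InjOn (fun i => decide (0 ≤ x i - round (x i))) (F : Set ι) := by
    intro i hi j hj hij
    by_contra hne
    have hi' := Finset.mem_filter.mp hi
    have hj' := Finset.mem_filter.mp hj
    have hsep' := hsep i hi'.1 j hj'.1 hne
    have h1 : |x i - round (x i)| < a + δ := hi'.2.2
    have h2 : a ≤ |x i - round (x i)| := hi'.2.1
    have h3 : |x j - round (x j)| < a + δ := hj'.2.2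
    have h4 : a ≤ |x j - round (x j)| := hj'.2.1
    have hij' : (0 ≤ x i - round (x i) ↔ 0 ≤ x j - round (x j)) := by
      simpa using hij
    have hlt : |(x i - round (x i)) - (x j - round (x j))| < δ := by
      rcases le_or_gt 0 (x i - round (x i)) with h | h
      · have h' : 0 ≤ x j - round (x j) := hij'.mp h
        rw [abs_of_nonneg h] at h1 h2
        rw [abs_of_nonneg h'] at h3 h4
        rw [abs_lt]; constructor <;> linarith
      · have h' : x j - round (x j) < 0 := by
          by_contra hc
          exact absurd (hij'.mpr (not_lt.mp hc)) (not_le.mpr h)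
        rw [abs_of_neg h] at h1 h2
        rw [abs_of_neg h'] at h3 h4
        rw [abs_lt]; constructor <;> linarith
    have hle : distInt (x i - x j) ≤ |(x i - round (x i)) - (x j - round (x j))| := by
      have := distInt_le_abs_sub_int (x i - x j) (round (x i) - round (x j))
      push_cast at this
      convert this using 2; ring
    linarith
  have := Finset.card_le_card_of_injOn (fun i => decide (0 ≤ x i - round (x i)))
    (fun i _ => Finset.mem_coe.mpr (Finset.mem_univ _)) key
  simpa using this

/-- **Well-spaced sums, I** (the substance of Nathanson's Lemmas 4.8–4.9): if the points `x i`,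
`i ∈ S`, are pairwise `δ`-separated modulo `1` and all satisfy `‖x i‖ ≥ δ`, then
`∑_{i ∈ S} 1/(2‖x i‖) ≤ δ⁻¹ (1 + log m)` for every natural number `m ≥ 1/(2δ)`: the window
`[sδ, (s+1)δ)`, `1 ≤ s ≤ m`, contains at most two of the `‖x i‖`, each contributing `≤ 1/(2sδ)`.
[folklore] -/
theorem sum_inv_distInt_le_of_separated (hδ : 0 < δ) {m : ℕ} (hm : 1 / (2 * δ) ≤ m)
    (hsep : ∀ i ∈ S, ∀ j ∈ S, i ≠ j → δ ≤ distInt (x i - x j))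
    (hfar : ∀ i ∈ S, δ ≤ distInt (x i)) :
    ∑ i ∈ S, 1 / (2 * distInt (x i)) ≤ (1 / δ) * (1 + Real.log m) := by
  classical
  set bin : ι → ℕ := fun i => ⌊distInt (x i) / δ⌋₊ with hbin
  have hmaps : ∀ i ∈ S, bin i ∈ Finset.Icc 1 m := by
    intro i hi
    rw [Finset.mem_Icc]
    constructor
    · apply Nat.le_floor
      rw [Nat.cast_one, le_div_iff₀ hδ, one_mul]
      exact hfar i hi
    · apply Nat.floor_le_of_le
      calc distInt (x i) / δ ≤ (1 / 2) / δ := by gcongr; exact distInt_le_half _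
        _ = 1 / (2 * δ) := by field_simp
        _ ≤ m := hm
  rw [← Finset.sum_fiberwise_of_maps_to hmaps]
  have hfib : ∀ s ∈ Finset.Icc 1 m,
      ∑ i ∈ S.filter (fun i => bin i = s), 1 / (2 * distInt (x i)) ≤ 1 / (s * δ) := by
    intro s hs
    have hs1 : (1 : ℝ) ≤ s := by exact_mod_cast (Finset.mem_Icc.mp hs).1
    have hsδ : 0 < (s : ℝ) * δ := by positivity
    have hsub : S.filter (fun i => bin i = s) ⊆
        S.filter (fun i => s * δ ≤ distInt (x i) ∧ distInt (x i) < s * δ + δ) := by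
      intro i hi
      rw [Finset.mem_filter] at hi ⊢
      refine ⟨hi.1, ?_, ?_⟩
      · have h0 := Nat.floor_le (div_nonneg (distInt_nonneg (x i)) hδ.le)
        have h1 : ((bin i : ℕ) : ℝ) = s := by exact_mod_cast hi.2
        rw [hbin] at h1
        rw [h1] at h0
        rwa [le_div_iff₀ hδ] at h0
      · have h0 := Nat.lt_floor_add_one (distInt (x i) / δ)
        have h1 : ((bin i : ℕ) : ℝ) = s := by exact_mod_cast hi.2
        rw [hbin] at h1
        rw [h1, div_lt_iff₀ hδ] at h0
        linarith
    calc ∑ i ∈ S.filter (fun i => bin i = s), 1 / (2 * distInt (x i))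
        ≤ ∑ i ∈ S.filter (fun i => bin i = s), 1 / (2 * (s * δ)) := by
          apply Finset.sum_le_sum
          intro i hi
          have hi' := Finset.mem_filter.mp (hsub hi)
          gcongr
          exact hi'.2.1
      _ = (S.filter (fun i => bin i = s)).card * (1 / (2 * (s * δ))) := by
          rw [Finset.sum_const, nsmul_eq_mul]
      _ ≤ 2 * (1 / (2 * (s * δ))) := by
          gcongr
          calc ((S.filter (fun i => bin i = s)).card : ℝ)
              ≤ (S.filter (fun i => s * δ ≤ distInt (x i) ∧ distInt (x i) < s * δ + δ)).card := by
                exact_mod_cast Finset.card_le_card hsub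
            _ ≤ 2 := by
                exact_mod_cast card_filter_distInt_mem_Ico_le_two S x hsep (s * δ)
      _ = 1 / (s * δ) := by field_simp
  calc ∑ s ∈ Finset.Icc 1 m, ∑ i ∈ S.filter (fun i => bin i = s), 1 / (2 * distInt (x i))
      ≤ ∑ s ∈ Finset.Icc 1 m, 1 / ((s : ℝ) * δ) := Finset.sum_le_sum hfib
    _ = (1 / δ) * ∑ s ∈ Finset.Icc 1 m, ((s : ℝ))⁻¹ := by
        rw [Finset.mul_sum]
        refine Finset.sum_congr rfl fun s hs => ?_
        have hs1 : (0 : ℝ) < s := by exact_mod_cast (Finset.mem_Icc.mp hs).1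
        field_simp
    _ = (1 / δ) * (harmonic m : ℝ) := by
        rw [harmonic_eq_sum_Icc]; push_cast; rfl
    _ ≤ (1 / δ) * (1 + Real.log m) := by
        have := harmonic_le_one_add_log m
        have hδ' : 0 ≤ 1 / δ := by positivity
        exact mul_le_mul_of_nonneg_left this hδ'

/-- **Well-spaced sums, II**: if the points `x i`, `i ∈ S`, are pairwise `δ`-separated modulo
`1`, then `∑_{i ∈ S} min (V, 1/(2‖x i‖)) ≤ 2V + δ⁻¹ (1 + log m)` for every natural number
`m ≥ 1/(2δ)` and `V ≥ 0` (at most two points have `‖x i‖ < δ`; the others are handled by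
`sum_inv_distInt_le_of_separated`). [folklore] -/
theorem sum_geomBound_le_of_separated (hδ : 0 < δ) {m : ℕ} (hm : 1 / (2 * δ) ≤ m)
    (hsep : ∀ i ∈ S, ∀ j ∈ S, i ≠ j → δ ≤ distInt (x i - x j)) {V : ℝ} (hV : 0 ≤ V) :
    ∑ i ∈ S, geomBound V (x i) ≤ 2 * V + (1 / δ) * (1 + Real.log m) := by
  classical
  rw [← Finset.sum_filter_add_sum_filter_not S (fun i => distInt (x i) < δ)]
  refine add_le_add ?_ ?_
  · calc ∑ i ∈ S.filter (fun i => distInt (x i) < δ), geomBound V (x i)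
        ≤ ∑ i ∈ S.filter (fun i => distInt (x i) < δ), V :=
          Finset.sum_le_sum fun i _ => geomBound_le V (x i)
      _ = (S.filter (fun i => distInt (x i) < δ)).card * V := by
          rw [Finset.sum_const, nsmul_eq_mul]
      _ ≤ 2 * V := by
          gcongr
          have h := card_filter_distInt_mem_Ico_le_two S x hsep 0
          have hset : S.filter (fun i => distInt (x i) < δ) =
              S.filter (fun i => 0 ≤ distInt (x i) ∧ distInt (x i) < 0 + δ) := by
            refine Finset.filter_congr fun i _ => ?_
            simp [distInt_nonneg]
          rw [hset]; exact_mod_cast h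
  · calc ∑ i ∈ S.filter (fun i => ¬ distInt (x i) < δ), geomBound V (x i)
        ≤ ∑ i ∈ S.filter (fun i => ¬ distInt (x i) < δ), 1 / (2 * distInt (x i)) := by
          refine Finset.sum_le_sum fun i hi => ?_
          have hfar : δ ≤ distInt (x i) := not_lt.mp (Finset.mem_filter.mp hi).2
          exact geomBound_le_inv V (lt_of_lt_of_le hδ hfar)
      _ ≤ (1 / δ) * (1 + Real.log m) :=
          sum_inv_distInt_le_of_separated _ x hδ hm
            (fun i hi j hj hij =>
              hsep i (Finset.mem_filter.mp hi).1 j (Finset.mem_filter.mp hj).1 hij)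
            (fun i hi => not_lt.mp (Finset.mem_filter.mp hi).2)

end WellSpaced

/-! ### Separation of the points `αk` (Nathanson, Lemma 4.8) -/

/-- **Separation** (the heart of Nathanson's Lemma 4.8, §4.4): if `|α - a/q| ≤ q⁻²` with
`(a, q) = 1`, then `‖αm‖ ≥ 1/(2q)` for every integer `m` with `0 < |m| ≤ q/2`. Indeed `q ∤ am`,
so `‖am/q‖ ≥ 1/q`, while `|αm - am/q| ≤ |m|/q² ≤ 1/(2q)`.
[cite: Nathanson1996, §4.4, Lemma 4.8] -/
theorem le_distInt_mul_of_abs_le {α : ℝ} {a : ℤ} {q : ℕ} (hq : 1 ≤ q) (hcop : IsCoprime a q)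
    (hα : |α - a / q| ≤ 1 / (q : ℝ) ^ 2) {m : ℤ} (hm0 : m ≠ 0) (hm : |(m : ℝ)| ≤ q / 2) :
    1 / (2 * (q : ℝ)) ≤ distInt (α * m) := by
  have hq0 : (0 : ℝ) < q := by exact_mod_cast hq
  -- `q ∤ a m`
  have hndvd : ¬ ((q : ℤ) ∣ a * m) := by
    intro h
    have hqm : (q : ℤ) ∣ m := hcop.symm.dvd_of_dvd_mul_left h
    obtain ⟨c, hc⟩ := hqm
    have hc0 : c ≠ 0 := by
      rintro rfl
      simp at hc
      exact hm0 hc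
    have h1 : (1 : ℝ) ≤ |(c : ℝ)| := by exact_mod_cast Int.one_le_abs hc0
    have h2 : (q : ℝ) ≤ |(m : ℝ)| := by
      rw [hc]; push_cast; rw [abs_mul, abs_of_pos hq0]
      nlinarith
    linarith
  -- `‖am/q‖ ≥ 1/q`
  have h1 : 1 / (q : ℝ) ≤ distInt (((a * m : ℤ) : ℝ) / q) := by
    unfold distInt
    set n := round (((a * m : ℤ) : ℝ) / q) with hn
    have hne : (a * m : ℤ) - n * q ≠ 0 := by
      intro h
      apply hndvd
      exact ⟨n, by linarith⟩
    have h1' : (1 : ℝ) ≤ |(((a * m : ℤ) - n * q : ℤ) : ℝ)| := by exact_mod_cast Int.one_le_abs hne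
    have heq : ((a * m : ℤ) : ℝ) / q - n = ((((a * m : ℤ) - n * q : ℤ)) : ℝ) / q := by
      push_cast; field_simp
    rw [heq, abs_div, abs_of_pos hq0]
    exact div_le_div_of_nonneg_right h1' hq0.le
  -- `|αm - am/q| ≤ 1/(2q)`
  have h2 : distInt (α * m - ((a * m : ℤ) : ℝ) / q) ≤ 1 / (2 * q) := by
    calc distInt (α * m - ((a * m : ℤ) : ℝ) / q)
        ≤ |α * m - ((a * m : ℤ) : ℝ) / q - ((0 : ℤ) : ℝ)| := distInt_le_abs_sub_int _ 0
      _ = |α - a / q| * |(m : ℝ)| := by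
          rw [← abs_mul]; congr 1; push_cast; ring
      _ ≤ 1 / (q : ℝ) ^ 2 * (q / 2) := mul_le_mul hα hm (abs_nonneg _) (by positivity)
      _ = 1 / (2 * q) := by field_simp
  have h3 := distInt_sub_distInt_le (α * m) (((a * m : ℤ) : ℝ) / q)
  have h4 : 1 / (q : ℝ) - 1 / (2 * q) = 1 / (2 * q) := by field_simp; ring
  linarith

/-! ### Nathanson, Lemma 4.10 -/

/-- **Nathanson, Lemma 4.10** (GTM 164, §4.4), explicit form: if `|α - a/q| ≤ q⁻²` with
`(a, q) = 1` and `q ≥ 1`, then for every `U ≥ 1` and `N ≥ 0`,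
`∑_{1 ≤ k ≤ U} min (N/k, 1/(2‖αk‖)) ≤ 4 (N/q + U + q) (1 + log (qU))`
(the book: `≪ (N/q + U + q) log (2qU)`). Proof: split `[1, U]` into blocks of
`L = ⌊q/2⌋ + 1` consecutive integers `{k : ⌊k/L⌋ = j}`; within a block the points `αk` are
`1/(2q)`-separated (`le_distInt_mul_of_abs_le`), so the block `j ≥ 1` contributes at most
`2N/(jL) + 2q (1 + log q)` (`sum_geomBound_le_of_separated`) and the block `j = 0`, all of whose
points are `1/(2q)`-far from `0`, at most `2q (1 + log q)` (`sum_inv_distInt_le_of_separated`);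
finally `∑_{j ≤ U/L} 1/j ≤ 1 + log U` and `1/L < 2/q`.
[cite: Nathanson1996, §4.4, Lemma 4.10] -/
theorem sum_geomBound_div_le {α : ℝ} {a : ℤ} {q : ℕ} (hq : 1 ≤ q) (hcop : IsCoprime a q)
    (hα : |α - a / q| ≤ 1 / (q : ℝ) ^ 2) {N : ℝ} (hN : 0 ≤ N) {U : ℕ} (hU : 1 ≤ U) :
    ∑ k ∈ Icc 1 U, geomBound (N / k) (α * k) ≤
      4 * (N / q + U + q) * (1 + Real.log (q * U)) := by
  classical
  have hq0 : (0 : ℝ) < q := by exact_mod_cast hq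
  have hU0 : (0 : ℝ) < U := by exact_mod_cast hU
  set L : ℕ := q / 2 + 1 with hL
  have hL1 : 1 ≤ L := by omega
  have hLpos : 0 < L := hL1
  have hL0 : (0 : ℝ) < L := by exact_mod_cast hL1
  have hLq : ((L : ℕ) : ℝ) - 1 ≤ (q : ℝ) / 2 := by
    have : ((q / 2 : ℕ) : ℝ) ≤ (q : ℝ) / 2 := Nat.cast_div_le
    rw [hL]; push_cast; linarith
  have hqL : (q : ℝ) < 2 * L := by
    have : q < 2 * L := by omega
    exact_mod_cast this
  have hδ : (0 : ℝ) < 1 / (2 * q) := by positivity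
  have h2q : 1 / (1 / (2 * (q : ℝ))) = 2 * q := by field_simp
  have hm : 1 / (2 * (1 / (2 * (q : ℝ)))) ≤ (q : ℕ) := le_of_eq (by field_simp)
  have hlogq : 0 ≤ Real.log q := Real.log_nonneg (by exact_mod_cast hq)
  have hlogU : 0 ≤ Real.log U := Real.log_nonneg (by exact_mod_cast hU)
  -- separation inside a set of diameter `≤ q/2`
  have hsepblock : ∀ (B : Finset ℕ), (∀ k ∈ B, ∀ k' ∈ B, (k : ℝ) - k' ≤ (q : ℝ) / 2) →
      ∀ k ∈ B, ∀ k' ∈ B, k ≠ k' → 1 / (2 * (q : ℝ)) ≤ distInt (α * k - α * k') := by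
    intro B hB k hk k' hk' hne
    have hm0 : ((k : ℤ) - k' : ℤ) ≠ 0 := by
      intro h
      apply hne
      exact_mod_cast (sub_eq_zero.mp h)
    have habs : |(((k : ℤ) - k' : ℤ) : ℝ)| ≤ q / 2 := by
      rw [abs_le]; push_cast
      constructor <;> linarith [hB k' hk' k hk, hB k hk k' hk']
    have h := le_distInt_mul_of_abs_le hq hcop hα hm0 habs
    push_cast at h
    simpa [mul_sub] using h
  -- decomposition into blocks `j = ⌊k/L⌋`
  have hmaps : ∀ k ∈ Icc 1 U, k / L ∈ range (U / L + 1) := by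
    intro k hk
    rw [Finset.mem_range, Nat.lt_add_one_iff]
    exact Nat.div_le_div_right (Finset.mem_Icc.mp hk).2
  rw [← Finset.sum_fiberwise_of_maps_to hmaps]
  have hblock_mem : ∀ j, ∀ k ∈ (Icc 1 U).filter (fun k => k / L = j),
      j * L ≤ k ∧ k < j * L + L ∧ 1 ≤ k ∧ k ≤ U := by
    intro j k hk
    rw [Finset.mem_filter, Finset.mem_Icc] at hk
    obtain ⟨⟨hk1, hkU⟩, hkj⟩ := hk
    refine ⟨?_, ?_, hk1, hkU⟩
    · rw [← hkj]; exact Nat.div_mul_le_self k L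
    · rw [← hkj]; exact Nat.lt_div_mul_add hLpos
  have hbound : ∀ j ∈ range (U / L + 1),
      ∑ k ∈ (Icc 1 U).filter (fun k => k / L = j), geomBound (N / k) (α * k) ≤
        (if j = 0 then 0 else 2 * (N / (j * L))) + 2 * q * (1 + Real.log q) := by
    intro j _
    set B := (Icc 1 U).filter (fun k => k / L = j) with hB
    have hdiam : ∀ k ∈ B, ∀ k' ∈ B, (k : ℝ) - k' ≤ (q : ℝ) / 2 := by
      intro k hk k' hk'
      obtain ⟨_, h2, -, -⟩ := hblock_mem j k hk
      obtain ⟨h1', _, -, -⟩ := hblock_mem j k' hk'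
      have e1 : (k : ℝ) + 1 ≤ j * L + L := by exact_mod_cast h2
      have e2 : (j : ℝ) * L ≤ k' := by exact_mod_cast h1'
      linarith
    have hsep := hsepblock B hdiam
    by_cases hj0 : j = 0
    · subst hj0
      rw [if_pos rfl, zero_add]
      have hfar : ∀ k ∈ B, 1 / (2 * (q : ℝ)) ≤ distInt (α * k) := by
        intro k hk
        obtain ⟨-, h2, h1, -⟩ := hblock_mem 0 k hk
        have hkL : (k : ℝ) + 1 ≤ L := by
          have : k + 1 ≤ L := by simpa using h2
          exact_mod_cast this
        have hk0 : ((k : ℤ)) ≠ 0 := by exact_mod_cast (by omega : k ≠ 0)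
        have habs : |((k : ℤ) : ℝ)| ≤ q / 2 := by
          push_cast
          rw [abs_of_nonneg (by positivity)]
          linarith
        have := le_distInt_mul_of_abs_le hq hcop hα hk0 habs
        simpa using this
      calc ∑ k ∈ B, geomBound (N / k) (α * k) ≤ ∑ k ∈ B, 1 / (2 * distInt (α * k)) :=
            Finset.sum_le_sum fun k hk => geomBound_le_inv _ (lt_of_lt_of_le hδ (hfar k hk))
        _ ≤ (1 / (1 / (2 * (q : ℝ)))) * (1 + Real.log (q : ℕ)) :=
            sum_inv_distInt_le_of_separated B (fun k : ℕ => α * k) hδ hm hsep hfar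
        _ = 2 * q * (1 + Real.log q) := by rw [h2q]
    · rw [if_neg hj0]
      have hj1 : 1 ≤ j := Nat.one_le_iff_ne_zero.mpr hj0
      have hjL : (0 : ℝ) < j * L := by positivity
      calc ∑ k ∈ B, geomBound (N / k) (α * k) ≤ ∑ k ∈ B, geomBound (N / (j * L)) (α * k) := by
            refine Finset.sum_le_sum fun k hk => geomBound_mono ?_ _
            obtain ⟨h1, -, -, -⟩ := hblock_mem j k hk
            have : (j : ℝ) * L ≤ k := by exact_mod_cast h1
            exact div_le_div_of_nonneg_left hN hjL this
        _ ≤ 2 * (N / (j * L)) + (1 / (1 / (2 * (q : ℝ)))) * (1 + Real.log (q : ℕ)) :=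
            sum_geomBound_le_of_separated B (fun k : ℕ => α * k) hδ hm hsep (by positivity)
        _ = 2 * (N / (j * L)) + 2 * q * (1 + Real.log q) := by rw [h2q]
  -- summing the block bounds
  have hmain : ∑ j ∈ range (U / L + 1),
      (if j = 0 then (0 : ℝ) else 2 * (N / (j * L))) ≤ (4 * N / q) * (1 + Real.log U) := by
    rw [Finset.sum_range_succ']
    simp only [Nat.add_one_ne_zero, if_false, if_true, add_zero]
    have hharm : ∑ i ∈ range (U / L), 2 * (N / (((i : ℝ) + 1) * L)) =
        (2 * N / L) * (harmonic (U / L) : ℝ) := by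
      simp only [harmonic, Rat.cast_sum, Rat.cast_inv, Rat.cast_natCast, Finset.mul_sum]
      refine Finset.sum_congr rfl fun i _ => ?_
      have : (0 : ℝ) < (i : ℝ) + 1 := by positivity
      push_cast
      field_simp
    push_cast
    rw [hharm]
    have hUL : Real.log ((U / L : ℕ) : ℝ) ≤ Real.log U := by
      rcases Nat.eq_zero_or_pos (U / L) with h | h
      · rw [h]; simp [hlogU]
      · exact Real.log_le_log (by exact_mod_cast h) (by exact_mod_cast Nat.div_le_self U L)
    calc 2 * N / L * (harmonic (U / L) : ℝ) ≤ 2 * N / L * (1 + Real.log ((U / L : ℕ) : ℝ)) := by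
          have := harmonic_le_one_add_log (U / L)
          have h0 : 0 ≤ 2 * N / L := by positivity
          exact mul_le_mul_of_nonneg_left this h0
      _ ≤ (4 * N / q) * (1 + Real.log U) := by
          apply mul_le_mul _ (by linarith) _ (by positivity)
          · rw [div_le_div_iff₀ hL0 hq0]; nlinarith
          · have : 0 ≤ Real.log ((U / L : ℕ) : ℝ) := Real.log_natCast_nonneg _
            linarith
  have hconst : ∑ j ∈ range (U / L + 1), 2 * (q : ℝ) * (1 + Real.log q) ≤
      (4 * U + 2 * q) * (1 + Real.log q) := by
    rw [Finset.sum_const, Finset.card_range, nsmul_eq_mul]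
    have h1 : (((U / L + 1 : ℕ)) : ℝ) ≤ 2 * U / q + 1 := by
      push_cast
      have : ((U / L : ℕ) : ℝ) ≤ (U : ℝ) / L := Nat.cast_div_le
      have h2 : (U : ℝ) / L ≤ 2 * U / q := by
        rw [div_le_div_iff₀ hL0 hq0]; nlinarith
      linarith
    calc (((U / L + 1 : ℕ)) : ℝ) * (2 * q * (1 + Real.log q))
        ≤ (2 * U / q + 1) * (2 * q * (1 + Real.log q)) := by
          apply mul_le_mul_of_nonneg_right h1; positivity
      _ = (4 * U + 2 * q) * (1 + Real.log q) := by field_simp; ring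
  have hlogqU : Real.log (q * U) = Real.log q + Real.log U :=
    Real.log_mul hq0.ne' hU0.ne'
  calc ∑ j ∈ range (U / L + 1), ∑ k ∈ (Icc 1 U).filter (fun k => k / L = j),
        geomBound (N / k) (α * k)
      ≤ ∑ j ∈ range (U / L + 1),
          ((if j = 0 then 0 else 2 * (N / (j * L))) + 2 * q * (1 + Real.log q)) :=
        Finset.sum_le_sum hbound
    _ = ∑ j ∈ range (U / L + 1), (if j = 0 then (0 : ℝ) else 2 * (N / (j * L))) +
          ∑ j ∈ range (U / L + 1), 2 * (q : ℝ) * (1 + Real.log q) := Finset.sum_add_distrib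
    _ ≤ (4 * N / q) * (1 + Real.log U) + (4 * U + 2 * q) * (1 + Real.log q) :=
        add_le_add hmain hconst
    _ ≤ (4 * N / q) * (1 + Real.log (q * U)) + (4 * U + 4 * q) * (1 + Real.log (q * U)) := by
        rw [hlogqU]
        apply add_le_add
        · apply mul_le_mul_of_nonneg_left _ (by positivity); linarith
        · apply mul_le_mul _ _ (by positivity) (by positivity) <;> linarith
    _ = 4 * (N / q + U + q) * (1 + Real.log (q * U)) := by ring

/-! ### Partial summation with logarithmic weights (Nathanson, proof of Lemma 8.6) -/

/-- Shifted geometric sums: `∑_{i < k} e((i+1)x) = ∑_{1 ≤ n ≤ k} e(nx)`. [folklore] -/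
theorem sum_range_fourierChar_succ_mul (k : ℕ) (x : ℝ) :
    ∑ i ∈ range k, (𝐞 (((i : ℝ) + 1) * x) : ℂ) = ∑ n ∈ Icc 1 k, (𝐞 ((n : ℝ) * x) : ℂ) := by
  have hI : Icc 1 k = Ico 1 (k + 1) := by
    ext n; simp only [Finset.mem_Icc, Finset.mem_Ico]; omega
  rw [hI, Finset.sum_Ico_eq_sum_range]
  simp only [Nat.add_sub_cancel]
  refine Finset.sum_congr rfl fun i _ => ?_
  rw [show ((1 + i : ℕ) : ℝ) = (i : ℝ) + 1 by push_cast; ring]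

/-- **Partial summation with logarithmic weights** (Nathanson, §8.5, proof of Lemma 8.6):
`‖∑_{1 ≤ r ≤ M} (log r) e(rx)‖ ≤ 2 log M · min (V, 1/(2‖x‖))` whenever `M ≤ V` (Abel summation:
the weights `log r` are nondecreasing of total variation `log M`, and every partial sum
`∑_{r ≤ k} e(rx)`, `k ≤ M`, is bounded by `min (V, 1/(2‖x‖))`, Lemma 4.7).
[cite: Nathanson1996, §8.5, proof of Lemma 8.6] -/
theorem norm_sum_log_mul_fourierChar_le {M : ℕ} {V : ℝ} (hMV : (M : ℝ) ≤ V) (x : ℝ) :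
    ‖∑ r ∈ Icc 1 M, (Real.log r : ℂ) * (𝐞 ((r : ℝ) * x) : ℂ)‖ ≤
      2 * Real.log M * geomBound V x := by
  rcases Nat.eq_zero_or_pos M with rfl | hM
  · simp
  have hV0 : 0 ≤ V := le_trans (Nat.cast_nonneg M) hMV
  have hG0 : 0 ≤ geomBound V x := geomBound_nonneg hV0 x
  set f : ℕ → ℂ := fun i => (Real.log ((i : ℝ) + 1) : ℂ) with hf
  set g : ℕ → ℂ := fun i => (𝐞 (((i : ℝ) + 1) * x) : ℂ) with hg
  have hshift : ∑ r ∈ Icc 1 M, (Real.log r : ℂ) * (𝐞 ((r : ℝ) * x) : ℂ) =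
      ∑ i ∈ range M, f i • g i := by
    have hI : Icc 1 M = Ico 1 (M + 1) := by
      ext n; simp only [Finset.mem_Icc, Finset.mem_Ico]; omega
    rw [hI, Finset.sum_Ico_eq_sum_range]
    simp only [Nat.add_sub_cancel, hf, hg, smul_eq_mul]
    refine Finset.sum_congr rfl fun i _ => ?_
    rw [show ((1 + i : ℕ) : ℝ) = (i : ℝ) + 1 by push_cast; ring]
  rw [hshift, Finset.sum_range_by_parts f g]
  have hG : ∀ k ≤ M, ‖∑ i ∈ range k, g i‖ ≤ geomBound V x := by
    intro k hk
    rw [hg, sum_range_fourierChar_succ_mul]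
    exact norm_sum_Icc_fourierChar_le_geomBound x (le_trans (by exact_mod_cast hk) hMV)
  have hM1 : ((M - 1 : ℕ) : ℝ) + 1 = M := by
    rw [Nat.cast_sub hM]; push_cast; ring
  have hfM : f (M - 1) = (Real.log M : ℂ) := by
    rw [hf]; simp only [hM1]
  have hdiff : ∀ i : ℕ,
      f (i + 1) - f i = ((Real.log ((i : ℝ) + 2) - Real.log ((i : ℝ) + 1) : ℝ) : ℂ) := by
    intro i; rw [hf]; push_cast; ring_nf
  have hdiff_nonneg : ∀ i : ℕ, 0 ≤ Real.log ((i : ℝ) + 2) - Real.log ((i : ℝ) + 1) := by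
    intro i
    have := Real.log_le_log (by positivity : (0 : ℝ) < i + 1) (by linarith : (i : ℝ) + 1 ≤ i + 2)
    linarith
  have htel : ∑ i ∈ range (M - 1), (Real.log ((i : ℝ) + 2) - Real.log ((i : ℝ) + 1)) =
      Real.log M := by
    have h := Finset.sum_range_sub (fun i : ℕ => Real.log ((i : ℝ) + 1)) (M - 1)
    simp only [Nat.cast_add, Nat.cast_one, Nat.cast_zero, zero_add, Real.log_one, sub_zero,
      hM1] at h
    rw [← h]
    refine Finset.sum_congr rfl fun i _ => ?_
    ring_nf
  calc ‖f (M - 1) • ∑ i ∈ range M, g i -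
        ∑ i ∈ range (M - 1), (f (i + 1) - f i) • ∑ j ∈ range (i + 1), g j‖
      ≤ ‖f (M - 1) • ∑ i ∈ range M, g i‖ +
        ‖∑ i ∈ range (M - 1), (f (i + 1) - f i) • ∑ j ∈ range (i + 1), g j‖ := norm_sub_le _ _
    _ ≤ Real.log M * geomBound V x +
        ∑ i ∈ range (M - 1), (Real.log ((i : ℝ) + 2) - Real.log ((i : ℝ) + 1)) *
          geomBound V x := by
        refine add_le_add ?_ ((norm_sum_le _ _).trans (Finset.sum_le_sum fun i hi => ?_))
        · rw [hfM, norm_smul, Complex.norm_real, Real.norm_of_nonneg (Real.log_natCast_nonneg M)]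
          exact mul_le_mul_of_nonneg_left (hG M le_rfl) (Real.log_natCast_nonneg M)
        · rw [hdiff, norm_smul, Complex.norm_real, Real.norm_of_nonneg (hdiff_nonneg i)]
          refine mul_le_mul_of_nonneg_left (hG (i + 1) ?_) (hdiff_nonneg i)
          have := Finset.mem_range.mp hi; omega
    _ = 2 * Real.log M * geomBound V x := by
        rw [← Finset.sum_mul, htel]; ring

/-! ### Exponential sums attached to arithmetic functions -/

/-- `∑_{1 ≤ n ≤ N} f(n) e(nα)`, the exponential sum with coefficients `f`
(so that `Literature.primeExpSum N α` is the case `f = Λ`). [folklore] -/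
def afExpSum (f : ℕ → ℝ) (N : ℕ) (α : ℝ) : ℂ :=
  ∑ n ∈ Icc 1 N, (f n : ℂ) * (𝐞 ((n : ℝ) * α) : ℂ)

/-- The trivial bound `‖∑ f(n) e(nα)‖ ≤ ∑ |f(n)|`. [folklore] -/
theorem norm_afExpSum_le (f : ℕ → ℝ) (N : ℕ) (α : ℝ) :
    ‖afExpSum f N α‖ ≤ ∑ n ∈ Icc 1 N, |f n| := by
  unfold afExpSum
  refine (norm_sum_le _ _).trans (le_of_eq (Finset.sum_congr rfl fun n _ => ?_))
  rw [norm_mul, norm_fourierChar, mul_one, Complex.norm_real, Real.norm_eq_abs]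

/-- Expansion of the exponential sum of a Dirichlet convolution:
`∑_{n ≤ N} (f * g)(n) e(nα) = ∑_{d ≤ N} f(d) ∑_{m ≤ N/d} g(m) e(m · dα)`. [folklore] -/
theorem afExpSum_mul (f g : ArithmeticFunction ℝ) (N : ℕ) (α : ℝ) :
    afExpSum (⇑(f * g)) N α =
      ∑ d ∈ Icc 1 N, (f d : ℂ) * ∑ m ∈ Icc 1 (N / d), (g m : ℂ) * (𝐞 ((m : ℝ) * (α * d)) : ℂ) := by
  unfold afExpSum
  have h1 : ∀ n ∈ Icc 1 N, (((f * g) n : ℝ) : ℂ) * (𝐞 ((n : ℝ) * α) : ℂ) =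
      ∑ p ∈ n.divisorsAntidiagonal,
        (f p.1 : ℂ) * ((g p.2 : ℂ) * (𝐞 ((p.2 : ℝ) * (α * p.1)) : ℂ)) := by
    intro n _
    rw [ArithmeticFunction.mul_apply]
    push_cast
    rw [Finset.sum_mul]
    refine Finset.sum_congr rfl fun p hp => ?_
    have hn : p.1 * p.2 = n := (Nat.mem_divisorsAntidiagonal.mp hp).1
    rw [← hn]
    push_cast
    ring_nf
  rw [Finset.sum_congr rfl h1, Literature.NumberTheory.Sieve.SquarefreeSums.sum_Icc_sum_divisorsAntidiagonal
    (fun d m : ℕ => (f d : ℂ) * ((g m : ℂ) * (𝐞 ((m : ℝ) * (α * d)) : ℂ))) N]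
  simp only [Finset.mul_sum]

end Literature.NumberTheory.Sieve.Vinogradov
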